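import Literature.NumberTheory.EllipticCurves.ModularCurve
import Literature.NumberTheory.EllipticCurves.Greenberg1999.TwoTorsionMuInvariant
import Summits.BirchSwinnertonDyer.BirchSwinnertonDyer.Theorems.EisensteinDepletionAtTwoStarHalfPeriodRoots
import HarnessLib

/-!
# Line `star` (crux E1M, stmt-BirchSwinnertonDyer-20341), stub `StarPlusOddClass` — helper 3: a rational 2-torsion abscissa is a half-period
# value of `℘` for the Néron lattice

Lead bsd-rank2-star-p1 GEN 4.  For `W₀/ℚ` with a Néron-type period pair `L` (`IsNeronLatticeOf (W₀.baseChange ℂ) L`: `g₂(L) = c₄/12`,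
`g₃(L) = c₆/216`) and a rational point `(x, y)` of order `2` (`2y + a₁x + a₃ = 0`): `x` is a root of the 2-division cubic
`4x³ + b₂x² + 2b₄x + b₆` (tree `fourXCubed_add_eq_zero_of_twoTorsion`), which is `4(x + b₂/12)³ − g₂(x + b₂/12) − g₃`
(`c₄ = b₂² − 24b₄`, `c₆ = −b₂³ + 36b₂b₄ − 216b₆`); hence (helper 2, `eq_weierstrassP_halfPeriod_of_cubic_eq_zero`) `x + b₂/12 = ℘_L(h)`
for one of the three half-periods `h ∈ {ω₁/2, ω₂/2, (ω₁+ω₂)/2}` — i.e. `x = x(h) := ℘_L(h) − b₂/12` is the abscissa of the 2-torsion point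
`h (mod Λ)` of `ℂ/Λ ≃ W₀(ℂ)` (Silverman AEC VI.3.6).  Steps (iv) + (iii, algebraic half) of the road to `StarPlusOddClass` (Lines/star v4.0).
-/

set_option linter.dupNamespace false

namespace Summit.BirchSwinnertonDyer.BirchSwinnertonDyer.Theorems.DepletionAtTwo

open PeriodPair WeierstrassCurve
open Literature.NumberTheory.EllipticCurves.ModularForms
open Literature.NumberTheory.EllipticCurves.Greenberg1999

/-- The 2-division cubic is the Weierstrass cubic of the Néron lattice, shifted by `b₂/12`:
`4(x + b₂/12)³ − g₂(x + b₂/12) − g₃ = 4x³ + b₂x² + 2b₄x + b₆` when `g₂ = c₄/12`, `g₃ = c₆/216`. [cite: SilvermanAEC2009, III.1 and VI.3.6] -/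
theorem weierstrassCubic_shift_eq (W₀ : WeierstrassCurve ℚ) {L : PeriodPair} (hL : IsNeronLatticeOf (W₀.baseChange ℂ) L) (x : ℂ) :
    4 * (x + (W₀.b₂ : ℂ) / 12) ^ 3 - L.g₂ * (x + (W₀.b₂ : ℂ) / 12) - L.g₃ =
      4 * x ^ 3 + (W₀.b₂ : ℂ) * x ^ 2 + 2 * (W₀.b₄ : ℂ) * x + (W₀.b₆ : ℂ) := by
  have h₂ : L.g₂ = ((W₀.b₂ : ℂ) ^ 2 - 24 * (W₀.b₄ : ℂ)) / 12 := by
    rw [hL.1, WeierstrassCurve.c₄, WeierstrassCurve.baseChange, map_b₂, map_b₄]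
    simp
  have h₃ : L.g₃ = (-(W₀.b₂ : ℂ) ^ 3 + 36 * (W₀.b₂ : ℂ) * (W₀.b₄ : ℂ) - 216 * (W₀.b₆ : ℂ)) / 216 := by
    rw [hL.2, WeierstrassCurve.c₆, WeierstrassCurve.baseChange, map_b₂, map_b₄, map_b₆]
    simp
  rw [h₂, h₃]
  ring

/-- **A rational 2-torsion abscissa is a root of the Weierstrass cubic of the Néron lattice.** [cite: SilvermanAEC2009, III.2.3 (ψ₂), VI.3.6] -/
theorem cubic_eq_zero_of_twoTorsion (W₀ : WeierstrassCurve ℚ) {L : PeriodPair} (hL : IsNeronLatticeOf (W₀.baseChange ℂ) L)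
    {x y : ℚ} (h : W₀.toAffine.Equation x y) (h2 : 2 * y + W₀.a₁ * x + W₀.a₃ = 0) :
    4 * ((x : ℂ) + (W₀.b₂ : ℂ) / 12) ^ 3 - L.g₂ * ((x : ℂ) + (W₀.b₂ : ℂ) / 12) - L.g₃ = 0 := by
  rw [weierstrassCubic_shift_eq W₀ hL]
  have h4 := fourXCubed_add_eq_zero_of_twoTorsion h h2
  exact_mod_cast congrArg (fun q : ℚ ↦ (q : ℂ)) h4 |>.trans Rat.cast_zero

/-- **A rational 2-torsion abscissa is a half-period value**: `x = ℘_L(h) − b₂/12` for `h ∈ {ω₁/2, ω₂/2, (ω₁+ω₂)/2}`.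
[cite: SilvermanAEC2009, VI.3.6] -/
theorem exists_halfPeriod_of_hasRationalTwoTorsionX (W₀ : WeierstrassCurve ℚ) {L : PeriodPair}
    (hL : IsNeronLatticeOf (W₀.baseChange ℂ) L) {x : ℚ} (hx : HasRationalTwoTorsionX W₀ x) :
    ∃ h : ℂ, (h = L.ω₁ / 2 ∨ h = L.ω₂ / 2 ∨ h = (L.ω₁ + L.ω₂) / 2) ∧ h ∉ L.lattice ∧ 2 * h ∈ L.lattice ∧
      L.weierstrassP h - (W₀.b₂ : ℂ) / 12 = (x : ℂ) := by
  obtain ⟨y, hxy, h2⟩ := hx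
  have hroot := cubic_eq_zero_of_twoTorsion W₀ hL hxy h2
  rcases eq_weierstrassP_halfPeriod_of_cubic_eq_zero L hroot with h | h | h
  · refine ⟨L.ω₁ / 2, Or.inl rfl, L.ω₁_div_two_notMem_lattice, ?_, by rw [← h]; ring⟩
    rw [mul_div_cancel₀ _ (two_ne_zero' ℂ)]; exact L.ω₁_mem_lattice
  · refine ⟨L.ω₂ / 2, Or.inr (Or.inl rfl), L.ω₂_div_two_notMem_lattice, ?_, by rw [← h]; ring⟩
    rw [mul_div_cancel₀ _ (two_ne_zero' ℂ)]; exact L.ω₂_mem_lattice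
  · refine ⟨(L.ω₁ + L.ω₂) / 2, Or.inr (Or.inr rfl), half_ω₁_add_ω₂_notMem_lattice L, ?_, by rw [← h]; ring⟩
    rw [mul_div_cancel₀ _ (two_ne_zero' ℂ)]; exact add_mem L.ω₁_mem_lattice L.ω₂_mem_lattice

end Summit.BirchSwinnertonDyer.BirchSwinnertonDyer.Theorems.DepletionAtTwo
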